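import Mathlib
import HarnessLib
import Literature.Computability.Complexity.Circuit
import Literature.Computability.Complexity.CircuitClasses
import Literature.Computability.Complexity.CircuitEval
import Literature.Computability.Complexity.Classes
import Literature.Computability.Complexity.BoolEncodings

/-!
# CVP universality in `P` as a projection (stub `stub_cvp` of the birth skeleton)

Support file for item stmt-PneNP-18541 (`CompositionIteration`, route `KrwChromaticSteering`).

**Statement.** There is ONE language `L ∈ P` — the tree's circuit-evaluation language
`CircEval.EvalLang` (Arora–Barak, Thm. 6.18, `EvalLang_mem_P`) — into whose slices every circuit
over `B₂` on `n ≥ 1` inputs embeds as a PROJECTION: for `C` there are a length `ℓ` with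
`⌊log₂ ℓ⌋ ≤ 8 · (⌊log₂(n + |C|)⌋ + 1)`, an input embedding `e x = ⟨x, desc C⟩` (`boolPair`: every bit of
`x` doubled, then the separator `01`, then the description of `C`) with `L.sliceFn ℓ (e x) = C(x)`,
and a coordinate map `back i = ⌊i/2⌋ ⊓ (n-1)` such that two embedded inputs differ only at
coordinates `i < 2n`, where `x (back i) ≠ y (back i)`.

Everything is bookkeeping on `boolPair` / `List.ofFn` around the tree's `evalFn_boolPair_desc` and
`length_desc_le`. Nothing here bears on P vs NP.
-/

set_option linter.dupNamespace false -- `Summit.PneNP.PneNP.…`: summit = sub-problem name (D-0017 single-conjunct layout)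

namespace Summit.PneNP.PneNP.Theorems.KrwCompositionIteration

open Literature.Computability.Complexity

/-- Reading a doubled string: position `i` of `⟨w⟩-doubled ++ tail` is `w[i/2]` for `i < 2|w|` and
`tail[i - 2|w|]` afterwards. -/
theorem getD_flatMap_double_append (w tail : List Bool) (i : ℕ) :
    ((w.flatMap fun b => [b, b]) ++ tail).getD i false =
      if i < 2 * w.length then w.getD (i / 2) false else tail.getD (i - 2 * w.length) false := by
  induction w generalizing i with
  | nil => simp
  | cons b w ih =>
    rcases i with _ | _ | j
    · have h0 : 0 < 2 * (w.length + 1) := by omega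
      simp [h0]
    · have h1 : 1 < 2 * (w.length + 1) := by omega
      simp [h1]
    · simp only [List.flatMap_cons, List.cons_append, List.nil_append, List.getD_cons_succ,
        List.length_cons]
      rw [ih j]
      have h2 : (j + 2) / 2 = j / 2 + 1 := by omega
      by_cases hj : j < 2 * w.length
      · rw [if_pos hj, if_pos (by omega), h2, List.getD_cons_succ]
      · rw [if_neg hj, if_neg (by omega)]
        congr 1
        omega

/-- Positions of the pair `⟨w, D⟩ = boolPair w D`: the doubled `w` for `i < 2|w|`, then the constant
separator-and-`D` part. -/
theorem getD_boolPair (w D : List Bool) (i : ℕ) :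
    (boolPair w D).getD i false =
      if i < 2 * w.length then w.getD (i / 2) false
      else (false :: true :: D).getD (i - 2 * w.length) false := by
  rw [boolPair, List.append_assoc]
  exact getD_flatMap_double_append w ([false, true] ++ D) i

/-- A list is `List.ofFn` of its `getD` read-out at its own length. -/
theorem ofFn_getD_eq (l : List Bool) {ℓ : ℕ} (hl : l.length = ℓ) :
    (List.ofFn fun i : Fin ℓ => l.getD i.val false) = l := by
  subst hl
  apply List.ext_getElem
  · simp
  · intro i h1 h2
    rw [List.getElem_ofFn, List.getD_eq_getElem?_getD, List.getElem?_eq_getElem h2]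
    rfl

/-- The evaluator on `⟨x, desc C⟩` computes `C(x)`, for `x : Fin n → Bool` read as the string
`List.ofFn x` (the tree's `evalFn_boolPair_desc`, transported along `|List.ofFn x| = n`). -/
theorem evalFn_boolPair_desc_ofFn {n : ℕ} (C : Circuit (Fin n)) (hC : ∀ g ∈ C.gates, g.arity ≤ 2)
    (x : Fin n → Bool) :
    CircEval.evalFn (boolPair (List.ofFn x) (CircEval.desc C)) = [C.eval x] := by
  have key : ∀ (w : List Bool) (hw : w.length = n),
      CircEval.evalFn (boolPair w (CircEval.desc C)) =
        [C.eval fun i => w.get (i.cast hw.symm)] := by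
    rintro w rfl
    exact CircEval.evalFn_boolPair_desc w C hC
  rw [key (List.ofFn x) (List.length_ofFn ..)]
  congr 2
  funext i
  simp

/-- The slice of `EvalLang` at the embedded input `⟨x, desc C⟩` is `C(x)`. -/
theorem boolIndicator_evalLang_boolPair {n : ℕ} (C : Circuit (Fin n))
    (hC : ∀ g ∈ C.gates, g.arity ≤ 2) (x : Fin n → Bool) :
    CircEval.EvalLang.boolIndicator (boolPair (List.ofFn x) (CircEval.desc C)) = C.eval x := by
  have hz := evalFn_boolPair_desc_ofFn C hC x
  cases hcx : C.eval x
  · rw [hcx] at hz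
    apply (Set.notMem_iff_boolIndicator _ _).1
    change ¬ (CircEval.evalFn (boolPair (List.ofFn x) (CircEval.desc C)) = [true])
    rw [hz]
    simp
  · rw [hcx] at hz
    apply (Set.mem_iff_boolIndicator _ _).1
    exact hz

/-- A crude size bound: `2n + 2 + (|C|+1)(8(n+|C|)+10) < 2 ^ (2 ⌊log₂(n+|C|)⌋ + 8)` for
`n + |C| ≥ 1`. -/
theorem embed_length_lt_pow {n s : ℕ} (hs : 1 ≤ n + s) :
    2 * n + 2 + (s + 1) * (8 * (n + s) + 10) < 2 ^ (2 * Nat.log 2 (n + s) + 8) := by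
  set t := n + s with ht
  have hlt : t < 2 ^ (Nat.log 2 t + 1) := Nat.lt_pow_succ_log_self (by norm_num) t
  set L := Nat.log 2 t with hL
  have h1 : 2 * n + 2 + (s + 1) * (8 * t + 10) ≤ 40 * (t * t) := by nlinarith
  have h2 : t * t < 2 ^ (L + 1) * 2 ^ (L + 1) :=
    Nat.mul_lt_mul_of_lt_of_le' hlt hlt.le (by positivity)
  have h3 : 2 ^ (2 * L + 8) = 64 * (2 ^ (L + 1) * 2 ^ (L + 1)) := by
    rw [← pow_add]
    rw [show 2 * L + 8 = 6 + (L + 1 + (L + 1)) by ring, pow_add]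
    norm_num
  rw [h3]
  omega

/-- The registered stub `stub_cvp` of the birth skeleton (verbatim signature): CVP universality
in `P` as a projection, witnessed by `L = CircEval.EvalLang`, `c₂ = 8`, `e x = boolPair (ofFn x)
(desc C)`, `back i = ⌊i/2⌋ ⊓ (n-1)`. -/
theorem stub_cvp : ∃ L ∈ Classes.P, ∃ c₂ : ℕ, ∀ n : ℕ, 1 ≤ n → ∀ C : Circuit (Fin n), C.IsOver B2 → ∃ ℓ : ℕ, 1 ≤ ℓ ∧ Nat.log 2 ℓ ≤ c₂ * (Nat.log 2 (n + C.size) + 1) ∧ ∃ (e : (Fin n → Bool) → (Fin ℓ → Bool)) (back : Fin ℓ → Fin n), (∀ x, L.sliceFn ℓ (e x) = C.eval x) ∧ (∀ x y : Fin n → Bool, ∀ i : Fin ℓ, e x i ≠ e y i → x (back i) ≠ y (back i)) := by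
  refine ⟨CircEval.EvalLang, CircEval.EvalLang_mem_P, 8, fun n hn C hB => ?_⟩
  have har : ∀ g ∈ C.gates, g.arity ≤ 2 := fun g hg => hB g hg
  set D := CircEval.desc C with hD
  set ℓ := 2 * n + 2 + D.length with hℓ
  have hlen : ∀ x : Fin n → Bool, (boolPair (List.ofFn x) D).length = ℓ := fun x => by
    rw [length_boolPair, List.length_ofFn]
  refine ⟨ℓ, by omega, ?_, fun x i => (boolPair (List.ofFn x) D).getD i.val false,
    fun i => ⟨min (i.val / 2) (n - 1), by omega⟩, fun x => ?_, fun x y i hi => ?_⟩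
  · -- the length bound: `⌊log₂ ℓ⌋ ≤ 2 ⌊log₂(n + |C|)⌋ + 7 ≤ 8 (⌊log₂(n + |C|)⌋ + 1)`
    have hDl : D.length ≤ (C.size + 1) * (8 * (n + C.size) + 10) := CircEval.length_desc_le C
    have hℓlt : ℓ < 2 ^ (2 * Nat.log 2 (n + C.size) + 8) :=
      lt_of_le_of_lt (by omega) (embed_length_lt_pow (s := C.size) (by omega))
    have := Nat.log_lt_of_lt_pow' (by omega) hℓlt
    omega
  · -- the slice value
    rw [Language.sliceFn, ofFn_getD_eq _ (hlen x)]
    exact boolIndicator_evalLang_boolPair C har x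
  · -- embedded inputs differ only inside the doubled `x`-part, at `x ⌊i/2⌋`
    dsimp only at hi ⊢
    rw [getD_boolPair, getD_boolPair, List.length_ofFn, List.length_ofFn] at hi
    by_cases hi2 : i.val < 2 * n
    · rw [if_pos hi2, if_pos hi2] at hi
      have hq : i.val / 2 < n := by omega
      have hmin : min (i.val / 2) (n - 1) = i.val / 2 := Nat.min_eq_left (by omega)
      have hx : (List.ofFn x).getD (i.val / 2) false = x ⟨i.val / 2, hq⟩ := by
        rw [List.getD_eq_getElem?_getD, List.getElem?_eq_getElem (by simpa using hq)]
        simp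
      have hy : (List.ofFn y).getD (i.val / 2) false = y ⟨i.val / 2, hq⟩ := by
        rw [List.getD_eq_getElem?_getD, List.getElem?_eq_getElem (by simpa using hq)]
        simp
      rw [hx, hy] at hi
      have hb : (⟨min (i.val / 2) (n - 1), by omega⟩ : Fin n) = ⟨i.val / 2, hq⟩ := Fin.ext hmin
      rw [hb]
      exact hi
    · rw [if_neg hi2, if_neg hi2] at hi
      exact absurd rfl hi

end Summit.PneNP.PneNP.Theorems.KrwCompositionIteration
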